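import Literature.Barriers.CriticalPhenomena.RigorousRGSmallParameterHeatCovariance
import HarnessLib

/-!
# `RigorousRGSmallParameter` (Slade, Theorem 1.4.1): the perturbative counterterm `P_j(V)_x` and
# `φ_pt(V)_x` are local polynomials in `𝒰 = span{1, τ_x, τ_x²}` (Slade §4.3)

Companion ("proof architecture") file of
`Literature/Barriers/CriticalPhenomena/RigorousRGSmallParameter.lean`, closing the loop between
the localisation operator of [BS-rg-loc] (files `…Loc*`, with Slade's range theorem
`locX_singleton_eq_localPoly`) and the functionals of Slade §4.3 (`…PerturbativeFunctionals`).
Slade writes (after (4.14)): "By translation invariance, `P_j(V)_x` does define a local polynomial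
with coefficients independent of `x`", and then `φ_pt(V) = e^{ℒ_{C_{j+1}}}V - P_j(V)` "maps `𝒰` to
itself, we write it as `(g,ν,u) ↦ (g_pt, ν_pt, u_pt)`" (4.15). The `x`-independence is
`…PerturbativeFunctionals.betaVec_Pfun_add`; this file proves that `P_j(V)_x` and `φ_pt(V)_x`
indeed lie in `𝒰`, i.e. are of the form `g'τ_x² + ν'τ_x + u'`:

1. the inputs are symmetric: `τ_x`, `V_x`, `V(Λ)` are invariant under the `O(n)` action `T_R` and
   under the automorphisms `T_Θ` fixing `x` (`tau_comp_compMap`, `localPolySum_univ_comp_fieldMap`, …);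
2. **`e^{tΔ_C}V_x` is explicit** — `Δ_Cτ_x = nC_{xx}`, `Δ_Cτ_x² = (2n+4)C_{xx}τ_x`
   (`lapC_tau`, `lapC_tau_sq`), whence
   `e^{tΔ_C}(gτ² + ντ + u) = gτ² + (ν + t(2n+4)gC_{xx})τ + (u + tnνC_{xx} + t²(n+2)ngC_{xx}²)`
   (`expL_localPoly`; `t = ½` gives `e^{ℒ_C}V_x`, the first-order part of Proposition 5.1.1);
3. locality: `F_C` is additive in its second argument, preserves `𝒩(S)`, and **vanishes on products
   of local polynomials beyond the finite range of `C`** (`FC_localPoly_far`, from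
   `…TphiHeatAlgebra.expLap_half_mul_eq`), so `F_w(V_x, V(Λ)) = Σ_{y ∈ reach(x,r)} F_w(V_x,V_y) ∈ 𝒩(reach(x,r))`;
4. **`Pfun_eq_localPoly`**: for finite-range, Euclidean-invariant `w = w_j` and (also
   translation-invariant) `C = C_{j+1}` whose ranges fit in a patch (`2r < M`, i.e. `j+1 < N`), in
   Slade's dimensional regime (`d_+ < 2[φ]+2`, `d_+ < 5[φ]`) and with truncation order `A ≥ 4`,
   the functional `G_x = e^{ℒ}W_j(V,x) + ½F_C(e^{ℒ}V_x, e^{ℒ}V(Λ))` is smooth, lies in `𝒩(reach(x,r))`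
   and is invariant under `T_R` (`R` orthogonal) and `T_Θ` (covariance of `Loc_x`, `e^{±ℒ}`, `F_C`
   from `…LocComponent`, `…LocCovariance`, `…HeatCovariance`), so the range theorem gives
   `P_j(V)_x = Loc_x G_x = g'τ_x² + ν'τ_x + u'`; and **`phiPtFun_eq_localPoly`** for `φ_pt(V)_x`.

Sources: G. Slade, arXiv:1611.06169, §4.3 (displays (4.9)–(4.15)), §4.2, §3.1 (finite range,
Euclidean invariance), Proposition 5.1.1; [BBS-rg-pt] arXiv:1403.7252 §2–§3.

## What this file provides (definitions with proved properties; no named fact)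

* `tau_comp_compMap`, `localPoly_comp_compMap`, `localPolySum_comp_compMap`, `tau_comp_fieldMap`,
  `localPoly_comp_fieldMap`, `localPolySum_univ_comp_fieldMap`.
* `sum_label_eq`, **`lapC_tau`**, **`lapC_tau_sq`**, `lapC_const`, **`lapC_localPoly`**,
  `lapPow_two_localPoly`, `lapPow_localPoly_eq_zero`, **`expL_localPoly`**.
* `expL_finset_sum`, `expL_const_mul`, **`FC_finset_sum_right`**, `dependsOn_expL`, `dependsOn_FC`,
  `dependsOn_localPoly`, `FinRange`, `disconnected_of_finRange`, **`FC_localPoly_far`**,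
  **`FC_localPoly_localPolySum`**, `dependsOn_FC_localPoly_localPolySum`.
* `EuclInv`, `TransInv.diag`, **`Pfun_eq_localPoly`**, **`phiPtFun_eq_localPoly`**.
* `localPoly_injective` (uniqueness of `(g,ν,u)`), **`phiPtMap`** (Slade's `φ_pt : ℝ³ → ℝ³`, (4.15)),
  `phiPtFun_eq_localPoly_phiPtMap`, `phiPtMap_eq_of_eq`.
* `transInv_of_diff`, `AxisSym.vec_sub`, `euclInv_of_diff`, `finRange_of_diff` (the three hypotheses for
  covariances of difference form `C_{xy} = f(y-x)`, as Slade's `C_j`, `w_j` are).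

## References

* [Slade2017] G. Slade, *Critical exponents for long-range O(n) models below the upper critical
  dimension*, Commun. Math. Phys. 358 (2018) 343–436, arXiv:1611.06169 — §4.2, §4.3, Prop. 5.1.1.
* [BrydgesSlade2015RGII] D. C. Brydges, G. Slade, *A renormalisation group method. II.*,
  J. Stat. Phys. 159 (2015) 461–491, arXiv:1403.7253 — §1.5.
-/

noncomputable section

namespace Literature.Barriers.CriticalPhenomena

namespace LongRangePhi4

namespace PTFun

open Finset Tphi RGNorm LocalPoly Loc Polymer Literature.Probability.LatticeModels
open scoped ContDiff

variable {d M n : ℕ} [NeZero M]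

/-! ### Invariance of `τ_x`, `V_x`, `V(Λ)` under `O(n)` and under automorphisms -/

omit [NeZero M] in
/-- **`τ_x ∘ T_R = τ_x` for orthogonal `R`** (`|Rφ_x|² = |φ_x|²`). [cite: Slade2017, §1.2 (O(n) invariance)] -/
theorem tau_comp_compMap {R : Fin n → Fin n → ℝ} (hR : IsOrth R) (x : TorusSite d M) :
    (fun φ => tau x (compMap R φ)) = tau (d := d) (M := M) (n := n) x := by
  funext φ
  simp only [tau, compMap_apply]
  congr 1
  -- `Σ_i (Σ_j R_{ij} φ_j)² = Σ_{j,k} (Σ_i R_{ij}R_{ik}) φ_jφ_k = Σ_j φ_j²`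
  have h : ∀ i, (∑ j, R i j * φ x j) ^ 2 = ∑ j, ∑ k, R i j * R i k * (φ x j * φ x k) := by
    intro i
    rw [sq, Finset.sum_mul_sum]
    exact Finset.sum_congr rfl fun j _ => Finset.sum_congr rfl fun k _ => by ring
  simp only [h]
  rw [Finset.sum_comm]
  refine Finset.sum_congr rfl fun j _ => ?_
  rw [Finset.sum_comm]
  have h2 : ∀ k, ∑ i, R i j * R i k * (φ x j * φ x k) = (∑ i, R i j * R i k) * (φ x j * φ x k) := fun k => by
    rw [Finset.sum_mul]
  simp only [h2, hR j]
  rw [Finset.sum_eq_single j]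
  · simp [sq]
  · intro k _ hk; simp [Ne.symm hk]
  · intro h'; exact absurd (Finset.mem_univ _) h'

omit [NeZero M] in
/-- `V_x ∘ T_R = V_x` for orthogonal `R`. [folklore] -/
theorem localPoly_comp_compMap {R : Fin n → Fin n → ℝ} (hR : IsOrth R) (g ν u : ℝ) (x : TorusSite d M) :
    (fun φ => localPoly g ν u x (compMap R φ)) = localPoly (d := d) (M := M) (n := n) g ν u x := by
  funext φ
  simp only [localPoly]
  rw [congrFun (tau_comp_compMap hR x) φ]

omit [NeZero M] in
/-- `V(X) ∘ T_R = V(X)` for orthogonal `R`. [folklore] -/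
theorem localPolySum_comp_compMap {R : Fin n → Fin n → ℝ} (hR : IsOrth R) (g ν u : ℝ) (X : Finset (TorusSite d M)) :
    (fun φ => localPolySum g ν u X (compMap R φ)) = localPolySum (d := d) (M := M) (n := n) g ν u X := by
  funext φ
  simp only [localPolySum]
  exact Finset.sum_congr rfl fun x _ => congrFun (localPoly_comp_compMap hR g ν u x) φ

omit [NeZero M] in
/-- **`τ_y ∘ T_Θ = τ_{Θ_a y}`.** [folklore] -/
theorem tau_comp_fieldMap (Θ : AxisSym d) (a y : TorusSite d M) :
    (fun φ => tau y (Θ.fieldMap a φ)) = tau (d := d) (M := M) (n := n) (Θ.pt a y) := by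
  funext φ; simp [tau, AxisSym.fieldMap_apply]

omit [NeZero M] in
/-- `V_y ∘ T_Θ = V_{Θ_a y}`; in particular `V_a ∘ T_Θ = V_a`. [folklore] -/
theorem localPoly_comp_fieldMap (Θ : AxisSym d) (a y : TorusSite d M) (g ν u : ℝ) :
    (fun φ => localPoly g ν u y (Θ.fieldMap a φ)) = localPoly (d := d) (M := M) (n := n) g ν u (Θ.pt a y) := by
  funext φ
  simp only [localPoly]
  rw [congrFun (tau_comp_fieldMap (n := n) Θ a y) φ]

/-- `V(Λ) ∘ T_Θ = V(Λ)`. [folklore] -/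
theorem localPolySum_univ_comp_fieldMap (Θ : AxisSym d) (a : TorusSite d M) (g ν u : ℝ) :
    (fun φ => localPolySum g ν u univ (Θ.fieldMap a φ)) = localPolySum (d := d) (M := M) (n := n) g ν u univ := by
  funext φ
  simp only [localPolySum]
  have h : ∀ y, localPoly (n := n) g ν u y (Θ.fieldMap a φ) = localPoly g ν u (Θ.pt a y) φ :=
    fun y => congrFun (localPoly_comp_fieldMap (n := n) Θ a y g ν u) φ
  simp only [h]
  exact Fintype.sum_equiv (Θ.ptEquiv a) _ _ fun y => rfl

/-! ### `Δ_C` and `e^{tΔ_C}` of `τ_x`, `τ_x²` and of the local polynomial (the first terms of [Slade2017] Prop. 5.1.1) -/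

/-- A sum over field labels supported on the fibre of `x`. [folklore] -/
theorem sum_label_eq (x : TorusSite d M) (f : TorusSite d M × Fin n → ℝ) (hf : ∀ p, p.1 ≠ x → f p = 0) :
    ∑ p, f p = ∑ i, f (x, i) := by
  rw [Fintype.sum_prod_type, Finset.sum_eq_single x]
  · intro y _ hy; exact Finset.sum_eq_zero fun i _ => hf (y, i) hy
  · intro h; exact absurd (Finset.mem_univ _) h

/-- **`Δ_C τ_x = n·C_{xx}`.** [folklore] -/
theorem lapC_tau (C : TorusSite d M → TorusSite d M → ℝ) (x : TorusSite d M) :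
    lapC (basisDir d M n) (lapCov C) (tau x) = fun _ => (n : ℝ) * C x x := by
  funext φ
  simp only [lapC, coeff_tau_two]
  have hf : ∀ p : TorusSite d M × Fin n, p.1 ≠ x →
      (∑ q : TorusSite d M × Fin n, lapCov (n := n) C p q * (if q.1 = x ∧ q = p then (1 : ℝ) else 0)) = 0 := by
    intro p hp
    refine Finset.sum_eq_zero fun q _ => ?_
    have : ¬(q.1 = x ∧ q = p) := fun h => hp (by rw [← h.2]; exact h.1)
    rw [if_neg this, mul_zero]
  rw [sum_label_eq x (fun p => ∑ q : TorusSite d M × Fin n, lapCov (n := n) C p q * (if q.1 = x ∧ q = p then (1 : ℝ) else 0)) hf]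
  have h : ∀ i : Fin n, ∑ q : TorusSite d M × Fin n, lapCov (n := n) C (x, i) q * (if q.1 = x ∧ q = (x, i) then (1 : ℝ) else 0) = C x x := by
    intro i
    rw [Finset.sum_eq_single (x, i)]
    · simp [lapCov]
    · intro q _ hq; rw [if_neg (fun h => hq h.2), mul_zero]
    · intro h'; exact absurd (Finset.mem_univ _) h'
  simp only [h, Finset.sum_const, Finset.card_univ, Fintype.card_fin, nsmul_eq_mul]

/-- **`Δ_C τ_x² = (2n+4)C_{xx} τ_x`.** [folklore] -/
theorem lapC_tau_sq (C : TorusSite d M → TorusSite d M → ℝ) (x : TorusSite d M) :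
    lapC (basisDir d M n) (lapCov C) (fun φ => tau x φ * tau x φ) = fun φ => (2 * (n : ℝ) + 4) * C x x * tau x φ := by
  have hτ := contDiff_tau (d := d) (M := M) (n := n) x
  rw [lapC_mul _ _ hτ hτ, lapC_tau]
  funext φ
  -- the cross term `Σ Ĉ_{pq}(τ_pτ_q + τ_qτ_p) = 4C_{xx}τ_x`
  set cx : TorusSite d M × Fin n → ℝ := fun p => if p.1 = x then φ p.1 p.2 else 0 with hcx
  have hc1 : ∀ p : TorusSite d M × Fin n, coeff (basisDir d M n) [p] (tau x) φ = cx p := by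
    intro p; rw [coeff_tau_one]; rfl
  have hcx0 : ∀ p : TorusSite d M × Fin n, p.1 ≠ x → cx p = 0 := fun p hp => by simp [hcx, hp]
  have hcxx : ∀ i : Fin n, cx (x, i) = φ x i := fun i => by simp [hcx]
  have hcross : ∑ p : TorusSite d M × Fin n, ∑ q : TorusSite d M × Fin n, lapCov (n := n) C p q *
      (coeff (basisDir d M n) [p] (tau x) φ * coeff (basisDir d M n) [q] (tau x) φ +
        coeff (basisDir d M n) [q] (tau x) φ * coeff (basisDir d M n) [p] (tau x) φ) = 4 * C x x * tau x φ := by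
    simp only [hc1]
    have hf : ∀ p : TorusSite d M × Fin n, p.1 ≠ x →
        (∑ q : TorusSite d M × Fin n, lapCov (n := n) C p q * (cx p * cx q + cx q * cx p)) = 0 := by
      intro p hp
      exact Finset.sum_eq_zero fun q _ => by rw [hcx0 p hp]; ring
    rw [sum_label_eq x (fun p : TorusSite d M × Fin n => ∑ q : TorusSite d M × Fin n, lapCov (n := n) C p q *
        (cx p * cx q + cx q * cx p)) hf]
    have h : ∀ i : Fin n, ∑ q : TorusSite d M × Fin n, lapCov (n := n) C (x, i) q * (cx (x, i) * cx q + cx q * cx (x, i)) =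
        2 * C x x * φ x i ^ 2 := by
      intro i
      rw [Finset.sum_eq_single (x, i)]
      · rw [hcxx]; simp [lapCov]; ring
      · intro q _ hq
        by_cases hq1 : q.1 = x
        · have hq2 : q.2 ≠ i := fun h => hq (Prod.ext hq1 h)
          simp [lapCov, Ne.symm hq2]
        · rw [hcx0 q hq1]; ring
      · intro h'; exact absurd (Finset.mem_univ _) h'
    rw [Finset.sum_congr rfl fun i _ => h i]
    simp only [tau, Finset.mul_sum]
    exact Finset.sum_congr rfl fun i _ => by ring
  rw [hcross]
  ring

/-- `Δ_C` of a constant vanishes. [folklore] -/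
theorem lapC_const (Ch : TorusSite d M × Fin n → TorusSite d M × Fin n → ℝ) (c : ℝ) :
    lapC (basisDir d M n) Ch (fun _ => c) = fun _ => 0 := by
  funext φ
  simp only [lapC]
  refine Finset.sum_eq_zero fun p _ => Finset.sum_eq_zero fun q _ => ?_
  rw [congrFun (coeff_const_eq_zero (basisDir d M n) c [p, q] (by simp)) φ, mul_zero]

/-- **`Δ_C V_x = (2n+4)gC_{xx}τ_x + nνC_{xx}`** for `V_x = gτ_x² + ντ_x + u`. [folklore] -/
theorem lapC_localPoly (C : TorusSite d M → TorusSite d M → ℝ) (g ν u : ℝ) (x : TorusSite d M) :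
    lapC (basisDir d M n) (lapCov C) (localPoly g ν u x) =
      fun φ => (2 * (n : ℝ) + 4) * C x x * g * tau x φ + (n : ℝ) * C x x * ν := by
  have hτ := contDiff_tau (d := d) (M := M) (n := n) x
  have hloc : localPoly (d := d) (M := M) (n := n) g ν u x =
      fun φ => (g * (tau x φ * tau x φ) + ν * tau x φ) + u := by
    funext φ; simp [localPoly, sq]
  rw [hloc, lapC_add _ _ ((contDiff_const.mul (hτ.mul hτ)).add (contDiff_const.mul hτ)) contDiff_const,
    lapC_add _ _ (contDiff_const.mul (hτ.mul hτ)) (contDiff_const.mul hτ),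
    lapC_const_mul _ _ g (hτ.mul hτ), lapC_const_mul _ _ ν hτ, lapC_tau_sq, lapC_tau, lapC_const]
  funext φ
  ring

/-- **`Δ_C² V_x = (2n+4)n g C_{xx}²`** and `Δ_C^k V_x = 0` for `k ≥ 3`. [folklore] -/
theorem lapPow_two_localPoly (C : TorusSite d M → TorusSite d M → ℝ) (g ν u : ℝ) (x : TorusSite d M) :
    lapPow (basisDir d M n) (lapCov C) 2 (localPoly g ν u x) = fun _ => (2 * (n : ℝ) + 4) * (n : ℝ) * g * C x x ^ 2 := by
  have hτ := contDiff_tau (d := d) (M := M) (n := n) x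
  show lapC (basisDir d M n) (lapCov C) (lapC (basisDir d M n) (lapCov C) (localPoly g ν u x)) = _
  rw [lapC_localPoly]
  rw [lapC_add _ _ (contDiff_const.mul hτ) contDiff_const, lapC_const_mul _ _ _ hτ, lapC_tau, lapC_const]
  funext φ; ring

/-- `Δ_C^k V_x = 0` for `k ≥ 3`. [folklore] -/
theorem lapPow_localPoly_eq_zero (C : TorusSite d M → TorusSite d M → ℝ) (g ν u : ℝ) (x : TorusSite d M) {k : ℕ} (hk : 3 ≤ k) :
    lapPow (basisDir d M n) (lapCov C) k (localPoly g ν u x) = fun _ => 0 := by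
  funext φ
  exact lapPow_apply_eq_zero _ _ (contDiff_localPoly g ν u x) (fun z hz => coeff_localPoly_eq_zero g ν u x z hz φ) (by omega)

/-- **`e^{tΔ_C}V_x` is again a local polynomial**:
`e^{tΔ_C}(gτ_x² + ντ_x + u) = gτ_x² + (ν + t(2n+4)gC_{xx})τ_x + (u + tnνC_{xx} + t²(n+2)n g C_{xx}²)`
(`A ≥ 2`; with `t = ½`: `e^{ℒ_C}V_x`, the first-order terms of [Slade2017] (5.3)–(5.6)). [cite: Slade2017, §4.3 (display (4.13)) and Proposition 5.1.1] -/
theorem expL_localPoly (C : TorusSite d M → TorusSite d M → ℝ) {A : ℕ} (hA : 2 ≤ A) (t g ν u : ℝ) (x : TorusSite d M) :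
    expL C A t (localPoly (n := n) g ν u x) =
      localPoly g (ν + t * ((2 * (n : ℝ) + 4) * g * C x x))
        (u + t * ((n : ℝ) * ν * C x x) + t ^ 2 * ((n : ℝ) + 2) * (n : ℝ) * g * C x x ^ 2) x := by
  funext φ
  unfold expL expLap
  -- only `k = 0, 1, 2` contribute
  have hsplit : ∑ k ∈ range (A + 1), t ^ k / (k.factorial : ℝ) * lapPow (basisDir d M n) (lapCov C) k (localPoly g ν u x) φ =
      ∑ k ∈ range 3, t ^ k / (k.factorial : ℝ) * lapPow (basisDir d M n) (lapCov C) k (localPoly g ν u x) φ := by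
    have hsub : range 3 ⊆ range (A + 1) := Finset.range_subset_range.2 (by omega)
    rw [← Finset.sum_subset hsub]
    intro k hk hk3
    rw [Finset.mem_range] at hk hk3
    rw [congrFun (lapPow_localPoly_eq_zero C g ν u x (k := k) (by omega)) φ, mul_zero]
  rw [hsplit, Finset.sum_range_succ, Finset.sum_range_succ, Finset.sum_range_one]
  simp only [pow_zero, Nat.factorial_zero, Nat.cast_one, div_one, one_mul, lapPow_zero, pow_one, Nat.factorial_one,
    Nat.factorial_two, Nat.cast_ofNat]
  have h1 : lapPow (basisDir d M n) (lapCov C) 1 (localPoly g ν u x) = lapC (basisDir d M n) (lapCov C) (localPoly g ν u x) := rfl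
  rw [h1, congrFun (lapC_localPoly C g ν u x) φ, congrFun (lapPow_two_localPoly C g ν u x) φ]
  simp only [localPoly]
  ring

/-! ### Linearity of `e^{tΔ_C}` and of `F_C` in its second argument -/

/-- `e^{tΔ_C}(Σ_i F_i) = Σ_i e^{tΔ_C}F_i`. [folklore] -/
theorem expL_finset_sum (C : TorusSite d M → TorusSite d M → ℝ) (A : ℕ) (t : ℝ) {β : Type*} (s : Finset β)
    {F : β → (TorusSite d M → Fin n → ℝ) → ℝ} (hF : ∀ i ∈ s, ContDiff ℝ ∞ (F i)) :
    expL C A t (fun ψ => ∑ i ∈ s, F i ψ) = fun φ => ∑ i ∈ s, expL C A t (F i) φ := by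
  funext φ
  simp only [expL, expLap]
  rw [Finset.sum_comm]
  refine Finset.sum_congr rfl fun k _ => ?_
  rw [congrFun (lapPow_finset_sum _ _ s hF k) φ, Finset.mul_sum]

/-- `e^{tΔ_C}(cF) = c·e^{tΔ_C}F`. [folklore] -/
theorem expL_const_mul (C : TorusSite d M → TorusSite d M → ℝ) (A : ℕ) (t c : ℝ)
    {F : (TorusSite d M → Fin n → ℝ) → ℝ} (hF : ContDiff ℝ ∞ F) :
    expL C A t (fun ψ => c * F ψ) = fun φ => c * expL C A t F φ := by
  funext φ
  simp only [expL, expLap, Finset.mul_sum]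
  refine Finset.sum_congr rfl fun k _ => ?_
  rw [congrFun (lapPow_const_mul _ _ c hF k) φ]; ring

/-- **`F_C(P, Σ_y Q_y) = Σ_y F_C(P, Q_y)`.** [folklore] -/
theorem FC_finset_sum_right (C : TorusSite d M → TorusSite d M → ℝ) (A : ℕ) {β : Type*} (s : Finset β)
    {P : (TorusSite d M → Fin n → ℝ) → ℝ} (hP : ContDiff ℝ ∞ P) {Q : β → (TorusSite d M → Fin n → ℝ) → ℝ}
    (hQ : ∀ i ∈ s, ContDiff ℝ ∞ (Q i)) :
    FC C A P (fun ψ => ∑ i ∈ s, Q i ψ) = fun φ => ∑ i ∈ s, FC C A P (Q i) φ := by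
  unfold FC
  rw [expL_finset_sum C A _ s hQ]
  have h : (fun ψ => expL C A (-2⁻¹) P ψ * ∑ i ∈ s, expL C A (-2⁻¹) (Q i) ψ) =
      fun ψ => ∑ i ∈ s, expL C A (-2⁻¹) P ψ * expL C A (-2⁻¹) (Q i) ψ := by
    funext ψ; rw [Finset.mul_sum]
  rw [h, expL_finset_sum C A _ s (fun i hi => (contDiff_expL C A _ hP).mul (contDiff_expL C A _ (hQ i hi)))]
  funext φ
  rw [Finset.mul_sum, ← Finset.sum_sub_distrib]

/-! ### Locality: `𝒩(S)` is preserved by `e^{tΔ_C}` and `F_C`; finite range kills far products -/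

/-- `e^{tΔ_C}` preserves `𝒩(S)`. [folklore] -/
theorem dependsOn_expL (C : TorusSite d M → TorusSite d M → ℝ) (A : ℕ) (t : ℝ) {S : Finset (TorusSite d M)}
    {F : (TorusSite d M → Fin n → ℝ) → ℝ} (hF : ContDiff ℝ ∞ F) (hS : DependsOn S F) : DependsOn S (expL C A t F) :=
  dependsOn_of_coeffSupp (contDiff_expL C A t hF) (CoeffSupp.expLap _ A t hF (coeffSupp_of_dependsOn hF hS))

/-- `F_C` preserves `𝒩(S)`. [folklore] -/
theorem dependsOn_FC (C : TorusSite d M → TorusSite d M → ℝ) (A : ℕ) {S : Finset (TorusSite d M)}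
    {P Q : (TorusSite d M → Fin n → ℝ) → ℝ} (hP : ContDiff ℝ ∞ P) (hQ : ContDiff ℝ ∞ Q) (hPS : DependsOn S P) (hQS : DependsOn S Q) :
    DependsOn S (FC C A P Q) := by
  have h1 : DependsOn S (expL C A 2⁻¹ (fun ψ => expL C A (-2⁻¹) P ψ * expL C A (-2⁻¹) Q ψ)) :=
    dependsOn_expL C A _ ((contDiff_expL C A _ hP).mul (contDiff_expL C A _ hQ))
      (DependsOn.mul (dependsOn_expL C A _ hP hPS) (dependsOn_expL C A _ hQ hQS))
  intro φ ψ hφψ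
  simp only [FC]
  rw [h1 φ ψ hφψ, hPS φ ψ hφψ, hQS φ ψ hφψ]

omit [NeZero M] in
/-- `V_x ∈ 𝒩({x})`. [folklore] -/
theorem dependsOn_localPoly (g ν u : ℝ) (x : TorusSite d M) : DependsOn {x} (localPoly (n := n) g ν u x) := by
  intro φ ψ h
  simp [localPoly, tau, h x (Finset.mem_singleton_self x)]

/-- **Finite range** `r` of a covariance: `C_{uv} ≠ 0` only if `u, v` are within `r` of each other. [cite: Slade2017, §3.1 ("the finite-range property Γ_{j;x,y} = 0 if |x - y| ≥ ½L^j")] -/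
def FinRange (C : TorusSite d M → TorusSite d M → ℝ) (r : ℕ) : Prop := ∀ u v, C u v ≠ 0 → v ∈ reach u r ∧ u ∈ reach v r

/-- Far sites are `C`-disconnected. [folklore] -/
theorem disconnected_of_finRange {C : TorusSite d M → TorusSite d M → ℝ} {r : ℕ} (hC : FinRange C r) {x y : TorusSite d M}
    (hxy : y ∉ reach x r) :
    Disconnected (lapCov (n := n) C) (({x} : Finset (TorusSite d M)) ×ˢ (Finset.univ : Finset (Fin n)))
      (({y} : Finset (TorusSite d M)) ×ˢ (Finset.univ : Finset (Fin n))) := by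
  intro p q
  constructor
  · intro hp hq
    simp only [Finset.mem_product, Finset.mem_singleton, Finset.mem_univ, and_true] at hp hq
    simp only [lapCov]
    split_ifs
    · by_contra h; rw [hp, hq] at h; exact hxy (hC x y h).1
    · rfl
  · intro hp hq
    simp only [Finset.mem_product, Finset.mem_singleton, Finset.mem_univ, and_true] at hp hq
    simp only [lapCov]
    split_ifs
    · by_contra h; rw [hp, hq] at h; exact hxy (hC y x h).2
    · rfl

/-- **`F_C(V_x, V'_y) = 0` for `y` beyond the range of `C` from `x`** (local polynomials of degree `4`, `A ≥ 4`). [cite: Slade2017, §4.3] -/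
theorem FC_localPoly_far {C : TorusSite d M → TorusSite d M → ℝ} {r : ℕ} (hC : FinRange C r) {A : ℕ} (hA : 4 ≤ A)
    (g ν u g' ν' u' : ℝ) {x y : TorusSite d M} (hxy : y ∉ reach x r) :
    FC C A (localPoly (n := n) g ν u x) (localPoly g' ν' u' y) = fun _ => 0 := by
  have h := expLap_half_mul_eq (basisDir d M n) (disconnected_of_finRange (n := n) hC hxy)
    (contDiff_localPoly g ν u x) (contDiff_localPoly g' ν' u' y)
    (coeffSupp_of_dependsOn (contDiff_localPoly g ν u x) (dependsOn_localPoly g ν u x))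
    (coeffSupp_of_dependsOn (contDiff_localPoly g' ν' u' y) (dependsOn_localPoly g' ν' u' y))
    (AF := 4) (AG := 4) (A := A) (fun φ z hz => coeff_localPoly_eq_zero g ν u x z hz φ)
    (fun φ z hz => coeff_localPoly_eq_zero g' ν' u' y z hz φ) (by omega)
  funext φ
  unfold FC expL
  rw [congrFun h φ, sub_self]

/-- **`F_C(V_x, V'(Λ)) = Σ_{y ∈ reach(x,r)} F_C(V_x, V'_y)`** for `C` of range `r`. [cite: Slade2017, §4.3 (display (4.11))] -/
theorem FC_localPoly_localPolySum {C : TorusSite d M → TorusSite d M → ℝ} {r : ℕ} (hC : FinRange C r) {A : ℕ} (hA : 4 ≤ A)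
    (g ν u g' ν' u' : ℝ) (x : TorusSite d M) :
    FC C A (localPoly (n := n) g ν u x) (localPolySum g' ν' u' univ) =
      fun φ => ∑ y ∈ reach x r, FC C A (localPoly g ν u x) (localPoly g' ν' u' y) φ := by
  unfold localPolySum
  rw [FC_finset_sum_right C A _ (contDiff_localPoly g ν u x) (fun y _ => contDiff_localPoly g' ν' u' y)]
  funext φ
  symm
  refine Finset.sum_subset (Finset.subset_univ _) fun y _ hy => ?_
  rw [congrFun (FC_localPoly_far hC hA g ν u g' ν' u' hy) φ]

/-- Hence `F_C(V_x, V'(Λ)) ∈ 𝒩(reach(x,r))`. [folklore] -/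
theorem dependsOn_FC_localPoly_localPolySum {C : TorusSite d M → TorusSite d M → ℝ} {r : ℕ} (hC : FinRange C r) {A : ℕ}
    (hA : 4 ≤ A) (g ν u g' ν' u' : ℝ) (x : TorusSite d M) :
    DependsOn (reach x r) (FC C A (localPoly (n := n) g ν u x) (localPolySum g' ν' u' univ)) := by
  rw [FC_localPoly_localPolySum hC hA]
  refine DependsOn.sum fun y hy => dependsOn_FC C A (contDiff_localPoly g ν u x) (contDiff_localPoly g' ν' u' y)
    ((dependsOn_localPoly g ν u x).mono (Finset.singleton_subset_iff.2 (mem_reach_self x r)))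
    ((dependsOn_localPoly g' ν' u' y).mono (Finset.singleton_subset_iff.2 hy))

/-! ### `P_j(V)_x ∈ 𝒰`: Slade's perturbative counterterm is a local polynomial `gτ² + ντ + u` -/

/-- Euclidean invariance of a covariance under the lattice automorphisms fixing a point. [cite: Slade2017, §3.1] -/
def EuclInv (C : TorusSite d M → TorusSite d M → ℝ) : Prop := ∀ (Θ : AxisSym d) (a u v : TorusSite d M), C (Θ.pt a u) (Θ.pt a v) = C u v

omit [NeZero M] in
/-- A translation-invariant covariance has a constant diagonal. [folklore] -/
theorem TransInv.diag {C : TorusSite d M → TorusSite d M → ℝ} (hC : TransInv C) (x y : TorusSite d M) : C y y = C x x := by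
  have h := hC x x (y - x)
  rwa [add_sub_cancel] at h

/-- **`P_j(V)_x` is a local polynomial `g'τ_x² + ν'τ_x + u'`** (Slade §4.3: "`P_j(V)_x` does define a
local polynomial"; here: in Slade's `𝒰`, by the symmetry/range theorem for `Loc_x`). Hypotheses: the
admissible data of `Loc`, Slade's dimensional regime `d_+ < 2[φ] + 2`, `d_+ < 5[φ]`, covariances
`C = C_{j+1}` and `w = w_j` of finite range, Euclidean invariant, `C` translation invariant, all ranges
and `⌊d_+⌋` within a patch `r` with `2r < M` (i.e. `j + 1 < N`), and truncation order `A ≥ 4` of the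
exponential series. [cite: Slade2017, §4.3 (displays (4.11)–(4.14) and the sentence following (4.14)), §4.2 (range 𝒰 of Loc_X)] -/
theorem Pfun_eq_localPoly {pN : ℕ} {dφ dplus : ℝ} (hA : LocAdm M n pN dφ dplus) [NeZero n]
    (h2 : dplus < 2 * dφ + 2) (h5 : dplus < 5 * dφ) (hK : 2 * ((⌊dplus⌋₊ : ℤ) + 1) < M)
    {C w : TorusSite d M → TorusSite d M → ℝ} {rC rw : ℕ} (hCr : FinRange C rC) (hwr : FinRange w rw)
    (hCE : EuclInv C) (hwE : EuclInv w) (hCt : TransInv C)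
    {A : ℕ} (hA4 : 4 ≤ A) {r : ℕ} (hrC : rC ≤ r) (hrw : rw ≤ r) (hrK : ⌊dplus⌋₊ ≤ r) (hrM : 2 * (r : ℤ) < M)
    (g ν u : ℝ) (x : TorusSite d M) :
    ∃ g' ν' u' : ℝ, Pfun (n := n) pN dφ dplus C w A g ν u x = localPoly g' ν' u' x := by
  set U : Finset (TorusSite d M) := reach x r with hUdef
  have hU : ∀ y ∈ U, ∀ k, 2 * |coord x y k| < M := by
    intro y hy k
    have := (mem_reach.1 hy) k
    linarith [hrM, this]
  have hxU : reach x ⌊dplus⌋₊ ⊆ U := reach_mono x hrK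
  have hXne : ({x} : Finset (TorusSite d M)).Nonempty := ⟨x, Finset.mem_singleton_self x⟩
  have hX : InPatch x ⌊dplus⌋₊ ({x} : Finset (TorusSite d M)) := by
    intro y hy j
    rw [Finset.mem_singleton.1 hy]
    simp only [coord, sub_self, ZMod.valMinAbs_zero, abs_zero, zero_add]
    omega
  have hxU' : ∀ y ∈ ({x} : Finset (TorusSite d M)), reach y ⌊dplus⌋₊ ⊆ U := fun y hy => by
    rw [Finset.mem_singleton.1 hy]; exact hxU
  -- the pieces
  set Vx := localPoly (d := d) (M := M) (n := n) g ν u x with hVx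
  set VΛ := localPolySum (d := d) (M := M) (n := n) g ν u univ with hVΛ
  have hVxs : ContDiff ℝ ∞ Vx := contDiff_localPoly g ν u x
  have hVΛs : ContDiff ℝ ∞ VΛ := ContDiff.sum fun y _ => contDiff_localPoly g ν u y
  set F := FC w A Vx VΛ with hFdef
  have hFs : ContDiff ℝ ∞ F := contDiff_FC w A hVxs hVΛs
  have hFU : DependsOn U F := (dependsOn_FC_localPoly_localPolySum hwr hA4 g ν u g ν u x).mono (reach_mono x hrw)
  have hLs : ContDiff ℝ ∞ (locPt pN dφ dplus x F) := contDiff_locPt pN dφ dplus x F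
  have hLU : DependsOn U (locPt pN dφ dplus x F) := dependsOn_locX hA.pos hK hxU' x F
  set W := Wfun (n := n) pN dφ dplus w A g ν u x with hWdef
  have hWs : ContDiff ℝ ∞ W := contDiff_Wfun pN dφ dplus w A g ν u x
  have hWeq : ∀ φ, W φ = 2⁻¹ * (F φ - locPt pN dφ dplus x F φ) := fun φ => rfl
  have hWU : DependsOn U W := by
    intro φ ψ h
    rw [hWeq φ, hWeq ψ, hFU φ ψ h, hLU φ ψ h]
  -- `e^{ℒ}V_x`, `e^{ℒ}V(Λ)` are local polynomials with shifted coefficients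
  set ν₁ : ℝ := ν + 2⁻¹ * ((2 * (n : ℝ) + 4) * g * C x x) with hν₁
  set u₁ : ℝ := u + 2⁻¹ * ((n : ℝ) * ν * C x x) + (2⁻¹) ^ 2 * ((n : ℝ) + 2) * (n : ℝ) * g * C x x ^ 2 with hu₁
  have hA2 : 2 ≤ A := by omega
  have hVx' : expL C A 2⁻¹ Vx = localPoly g ν₁ u₁ x := expL_localPoly C hA2 2⁻¹ g ν u x
  have hVΛ' : expL C A 2⁻¹ VΛ = localPolySum g ν₁ u₁ univ := by
    rw [hVΛ]
    unfold localPolySum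
    rw [expL_finset_sum C A _ _ (fun y _ => contDiff_localPoly g ν u y)]
    funext φ
    refine Finset.sum_congr rfl fun y _ => ?_
    rw [expL_localPoly C hA2 2⁻¹ g ν u y, hCt.diag x y]
  set H := FC C A (expL C A 2⁻¹ Vx) (expL C A 2⁻¹ VΛ) with hHdef
  have hHs : ContDiff ℝ ∞ H := contDiff_FC C A (contDiff_expL C A _ hVxs) (contDiff_expL C A _ hVΛs)
  have hHU : DependsOn U H := by
    rw [hHdef, hVx', hVΛ']
    exact (dependsOn_FC_localPoly_localPolySum hCr hA4 g ν₁ u₁ g ν₁ u₁ x).mono (reach_mono x hrC)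
  set G : (TorusSite d M → Fin n → ℝ) → ℝ := fun φ => expL C A 2⁻¹ W φ + 2⁻¹ * H φ with hGdef
  have hGs : ContDiff ℝ ∞ G := (contDiff_expL C A _ hWs).add (contDiff_const.mul hHs)
  have hGU : DependsOn U G := DependsOn.add (dependsOn_expL C A _ hWs hWU) (DependsOn.mul (fun _ _ _ => rfl) hHU)
  have hP : Pfun (n := n) pN dφ dplus C w A g ν u x = locX pN dφ dplus x {x} G := rfl
  -- symmetry of `G` under a linear `T` compatible with everything
  have hsym : ∀ T : (TorusSite d M → Fin n → ℝ) →L[ℝ] (TorusSite d M → Fin n → ℝ),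
      conjC T (lapCov (n := n) C) = lapCov C → conjC T (lapCov (n := n) w) = lapCov w →
      (fun φ => Vx (T φ)) = Vx → (fun φ => VΛ (T φ)) = VΛ →
      (fun φ => locPt pN dφ dplus x F (T φ)) = locPt pN dφ dplus x (fun φ => F (T φ)) →
      (fun φ => G (T φ)) = G := by
    intro T hTC hTw hTVx hTVΛ hTL
    have hTF : (fun φ => F (T φ)) = F := by
      rw [hFdef, ← FC_comp_clm hTw A hVxs hVΛs, hTVx, hTVΛ]
    have hTW : (fun φ => W (T φ)) = W := by
      funext φ
      rw [hWeq, hWeq, congrFun hTL φ, hTF, congrFun hTF φ]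
    have hP' : (fun φ => expL C A 2⁻¹ Vx (T φ)) = expL C A 2⁻¹ Vx := by
      have h := expLap_comp_clm hTC A 2⁻¹ hVxs
      rw [hTVx] at h
      exact h.symm
    have hQ' : (fun φ => expL C A 2⁻¹ VΛ (T φ)) = expL C A 2⁻¹ VΛ := by
      have h := expLap_comp_clm hTC A 2⁻¹ hVΛs
      rw [hTVΛ] at h
      exact h.symm
    have hTH : (fun φ => H (T φ)) = H := by
      have h := FC_comp_clm hTC A (contDiff_expL C A 2⁻¹ hVxs) (contDiff_expL C A 2⁻¹ hVΛs)
      rw [hP', hQ'] at h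
      exact h.symm
    have hW' : (fun φ => expL C A 2⁻¹ W (T φ)) = expL C A 2⁻¹ W := by
      have h := expLap_comp_clm hTC A 2⁻¹ hWs
      rw [hTW] at h
      exact h.symm
    funext φ
    have h1 := congrFun hW' φ
    have h2 := congrFun hTH φ
    show expL C A 2⁻¹ W (T φ) + 2⁻¹ * H (T φ) = expL C A 2⁻¹ W φ + 2⁻¹ * H φ
    rw [← h1, ← h2]
  -- the two symmetries
  have hO : ∀ R : Fin n → Fin n → ℝ, IsOrth R → (fun φ => G (compMap R φ)) = G := fun R hR =>
    hsym (compMap R) (conjC_compMap_of_isOrth hR C) (conjC_compMap_of_isOrth hR w)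
      (localPoly_comp_compMap hR g ν u x) (localPolySum_comp_compMap hR g ν u univ)
      (locX_comp_compMap hA R hXne hX hFs)
  have hrefl : ∀ k : Fin d, (fun φ => G ((reflAxis k).fieldMap x φ)) = G := by
    intro k
    have hEX : ({x} : Finset (TorusSite d M)).image ((reflAxis k).pt x) = {x} := by
      rw [Finset.image_singleton, AxisSym.pt_self]
    refine hsym ((reflAxis k).fieldMap x) (conjC_fieldMap _ x (hCE _ x)) (conjC_fieldMap _ x (hwE _ x)) ?_ ?_ ?_
    · rw [hVx, localPoly_comp_fieldMap, AxisSym.pt_self]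
    · rw [hVΛ, localPolySum_univ_comp_fieldMap]
    · have h := AxisSym.locX_comp_fieldMap (Θ := reflAxis k) hA hXne hX (by rw [hEX]; exact hX) hU hK hxU' hFs hFU
      rw [hEX] at h
      exact h
  obtain ⟨g', ν', u', h⟩ := locX_singleton_eq_localPoly hA x hU hK hxU h2 h5 hGs hGU hrefl hO
  exact ⟨g', ν', u', by rw [hP, h]⟩

/-- **`φ_pt(V)_x = e^{ℒ}V_x - P_j(V)_x` is a local polynomial `g_{pt}τ_x² + ν_{pt}τ_x + u_{pt}`** —
so Slade's `φ_pt : ℝ³ → ℝ³` (display (4.15)) is well defined; its explicit form is Proposition 5.1.1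
of [Slade2017] (the computation of [BBS-rg-pt], not carried out here). [cite: Slade2017, §4.3 (displays (4.13), (4.15))] -/
theorem phiPtFun_eq_localPoly {pN : ℕ} {dφ dplus : ℝ} (hA : LocAdm M n pN dφ dplus) [NeZero n]
    (h2 : dplus < 2 * dφ + 2) (h5 : dplus < 5 * dφ) (hK : 2 * ((⌊dplus⌋₊ : ℤ) + 1) < M)
    {C w : TorusSite d M → TorusSite d M → ℝ} {rC rw : ℕ} (hCr : FinRange C rC) (hwr : FinRange w rw)
    (hCE : EuclInv C) (hwE : EuclInv w) (hCt : TransInv C)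
    {A : ℕ} (hA4 : 4 ≤ A) {r : ℕ} (hrC : rC ≤ r) (hrw : rw ≤ r) (hrK : ⌊dplus⌋₊ ≤ r) (hrM : 2 * (r : ℤ) < M)
    (g ν u : ℝ) (x : TorusSite d M) :
    ∃ g' ν' u' : ℝ, phiPtFun (n := n) pN dφ dplus C w A g ν u x = localPoly g' ν' u' x := by
  obtain ⟨g₁, ν₁, u₁, hP⟩ := Pfun_eq_localPoly hA h2 h5 hK hCr hwr hCE hwE hCt hA4 hrC hrw hrK hrM g ν u x
  have hV := expL_localPoly (n := n) C (A := A) (by omega) 2⁻¹ g ν u x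
  refine ⟨g - g₁, ν + 2⁻¹ * ((2 * (n : ℝ) + 4) * g * C x x) - ν₁,
    u + 2⁻¹ * ((n : ℝ) * ν * C x x) + (2⁻¹) ^ 2 * ((n : ℝ) + 2) * (n : ℝ) * g * C x x ^ 2 - u₁, ?_⟩
  funext φ
  unfold phiPtFun
  rw [congrFun hV φ, congrFun hP φ]
  simp only [localPoly]
  ring

/-! ### Uniqueness of the coefficients of a local polynomial; `φ_pt` as a map `ℝ³ → ℝ³` -/

omit [NeZero M] in
/-- **The coefficients `(g, ν, u)` of `gτ_x² + ντ_x + u` are unique** (`n ≥ 1`). [folklore] -/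
theorem localPoly_injective [NeZero n] (x : TorusSite d M) {g ν u g' ν' u' : ℝ}
    (h : localPoly (d := d) (M := M) (n := n) g ν u x = localPoly g' ν' u' x) : g = g' ∧ ν = ν' ∧ u = u' := by
  -- evaluate at the fields `s·δ_{x,0}`: `τ_x = s²/2`
  have hev : ∀ s : ℝ, g * (s ^ 2 / 2) ^ 2 + ν * (s ^ 2 / 2) + u = g' * (s ^ 2 / 2) ^ 2 + ν' * (s ^ 2 / 2) + u' := by
    intro s
    have hτ : tau x (siteField (d := d) (M := M) x (fun i : Fin n => if i = 0 then s else 0)) = s ^ 2 / 2 := by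
      simp only [tau, siteField_self]
      rw [Finset.sum_eq_single (0 : Fin n)]
      · simp; ring
      · intro i _ hi; simp [hi]
      · intro h0; exact absurd (Finset.mem_univ _) h0
    have := congrFun h (siteField x (fun i : Fin n => if i = 0 then s else 0))
    simp only [localPoly, hτ] at this
    linarith [this]
  have h0 := hev 0
  have h1 := hev (Real.sqrt 2)
  have h2 := hev 2
  have hs : Real.sqrt 2 ^ 2 = 2 := Real.sq_sqrt (by norm_num)
  rw [hs] at h1
  norm_num at h0 h1 h2
  refine ⟨by linarith, by linarith, by linarith⟩

/-- **Slade's perturbative map `φ_pt = φ_{pt,j} : ℝ³ → ℝ³`, `(g,ν,u) ↦ (g_pt, ν_pt, u_pt)`** (display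
(4.15)), defined as the coefficient triple of the local polynomial `φ_pt(V)_x` (which exists by
`phiPtFun_eq_localPoly` and is unique by `localPoly_injective`; it does not depend on `x` by
translation invariance). Outside the hypotheses of `phiPtFun_eq_localPoly` the value is junk. [cite: Slade2017, §4.3 (display (4.15))] -/
def phiPtMap (pN : ℕ) (dφ dplus : ℝ) (C w : TorusSite d M → TorusSite d M → ℝ) (A : ℕ) (x : TorusSite d M)
    (V : ℝ × ℝ × ℝ) : ℝ × ℝ × ℝ := by
  classical
  exact if h : ∃ q : ℝ × ℝ × ℝ, phiPtFun (n := n) pN dφ dplus C w A V.1 V.2.1 V.2.2 x = localPoly q.1 q.2.1 q.2.2 x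
    then h.choose else 0

/-- `φ_pt(V)_x = g_pt τ_x² + ν_pt τ_x + u_pt` with `(g_pt, ν_pt, u_pt) = phiPtMap … (g,ν,u)`, under the
hypotheses of `phiPtFun_eq_localPoly`. [cite: Slade2017, §4.3 (displays (4.13), (4.15))] -/
theorem phiPtFun_eq_localPoly_phiPtMap {pN : ℕ} {dφ dplus : ℝ} (hA : LocAdm M n pN dφ dplus) [NeZero n]
    (h2 : dplus < 2 * dφ + 2) (h5 : dplus < 5 * dφ) (hK : 2 * ((⌊dplus⌋₊ : ℤ) + 1) < M)
    {C w : TorusSite d M → TorusSite d M → ℝ} {rC rw : ℕ} (hCr : FinRange C rC) (hwr : FinRange w rw)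
    (hCE : EuclInv C) (hwE : EuclInv w) (hCt : TransInv C)
    {A : ℕ} (hA4 : 4 ≤ A) {r : ℕ} (hrC : rC ≤ r) (hrw : rw ≤ r) (hrK : ⌊dplus⌋₊ ≤ r) (hrM : 2 * (r : ℤ) < M)
    (g ν u : ℝ) (x : TorusSite d M) :
    phiPtFun (n := n) pN dφ dplus C w A g ν u x =
      localPoly (phiPtMap (n := n) pN dφ dplus C w A x (g, ν, u)).1 (phiPtMap (n := n) pN dφ dplus C w A x (g, ν, u)).2.1
        (phiPtMap (n := n) pN dφ dplus C w A x (g, ν, u)).2.2 x := by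
  classical
  have hex : ∃ q : ℝ × ℝ × ℝ, phiPtFun (n := n) pN dφ dplus C w A g ν u x = localPoly q.1 q.2.1 q.2.2 x := by
    obtain ⟨g', ν', u', h⟩ := phiPtFun_eq_localPoly hA h2 h5 hK hCr hwr hCE hwE hCt hA4 hrC hrw hrK hrM g ν u x
    exact ⟨(g', ν', u'), h⟩
  have hdef : phiPtMap (n := n) pN dφ dplus C w A x (g, ν, u) = hex.choose := by
    unfold phiPtMap
    exact dif_pos hex
  rw [hdef]
  exact hex.choose_spec

/-- The triple is characterised by the identity (uniqueness of coefficients). [folklore] -/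
theorem phiPtMap_eq_of_eq {pN : ℕ} {dφ dplus : ℝ} (hA : LocAdm M n pN dφ dplus) [NeZero n]
    (h2 : dplus < 2 * dφ + 2) (h5 : dplus < 5 * dφ) (hK : 2 * ((⌊dplus⌋₊ : ℤ) + 1) < M)
    {C w : TorusSite d M → TorusSite d M → ℝ} {rC rw : ℕ} (hCr : FinRange C rC) (hwr : FinRange w rw)
    (hCE : EuclInv C) (hwE : EuclInv w) (hCt : TransInv C)
    {A : ℕ} (hA4 : 4 ≤ A) {r : ℕ} (hrC : rC ≤ r) (hrw : rw ≤ r) (hrK : ⌊dplus⌋₊ ≤ r) (hrM : 2 * (r : ℤ) < M)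
    (g ν u : ℝ) (x : TorusSite d M) {g' ν' u' : ℝ}
    (h : phiPtFun (n := n) pN dφ dplus C w A g ν u x = localPoly g' ν' u' x) :
    phiPtMap (n := n) pN dφ dplus C w A x (g, ν, u) = (g', ν', u') := by
  have h1 := phiPtFun_eq_localPoly_phiPtMap hA h2 h5 hK hCr hwr hCE hwE hCt hA4 hrC hrw hrK hrM g ν u x
  rw [h] at h1
  obtain ⟨e1, e2, e3⟩ := localPoly_injective (n := n) x h1
  ext <;> simp [← e1, ← e2, ← e3]

/-! ### Covariances of difference form `C_{xy} = f(y - x)`: the three hypotheses -/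

omit [NeZero M] in
/-- A covariance of difference form is translation invariant. [folklore] -/
theorem transInv_of_diff (f : TorusSite d M → ℝ) : TransInv (fun x y : TorusSite d M => f (y - x)) := by
  intro u u' v
  simp only [add_sub_add_right_eq_sub]

omit [NeZero M] in
/-- `Θ.vec` is odd. [folklore] -/
theorem AxisSym.vec_sub (Θ : AxisSym d) (u u' : TorusSite d M) : Θ.vec (u - u') = Θ.vec u - Θ.vec u' := by
  have h := Θ.vec_add (u - u') u'
  rw [sub_add_cancel] at h
  rw [h, add_sub_cancel_right]

omit [NeZero M] in
/-- A covariance of difference form with an axis-symmetric profile (`f ∘ Θ = f` for all signed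
permutations of the axes) is Euclidean invariant. [folklore] -/
theorem euclInv_of_diff {f : TorusSite d M → ℝ} (hf : ∀ (Θ : AxisSym d) (z : TorusSite d M), f (Θ.vec z) = f z) :
    EuclInv (fun x y : TorusSite d M => f (y - x)) := by
  intro Θ a u v
  simp only [AxisSym.pt]
  rw [show a + Θ.vec (v - a) - (a + Θ.vec (u - a)) = Θ.vec (v - a) - Θ.vec (u - a) by abel,
    ← AxisSym.vec_sub, show v - a - (u - a) = v - u by abel, hf]

/-- A covariance of difference form whose profile vanishes outside the cube of radius `r`
(`f(z) ≠ 0 ⇒ |z_j| ≤ r` for all `j`, `|·|` the centred residue) has finite range `r`. [folklore] -/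
theorem finRange_of_diff {f : TorusSite d M → ℝ} {r : ℕ}
    (hf : ∀ z : TorusSite d M, f z ≠ 0 → ∀ j, |((z j).valMinAbs : ℤ)| ≤ r) :
    FinRange (fun x y : TorusSite d M => f (y - x)) r := by
  intro u v huv
  have h := hf (v - u) huv
  have habs : ∀ z : ZMod M, |((-z).valMinAbs : ℤ)| = |(z.valMinAbs : ℤ)| := by
    intro z
    rw [← Int.natCast_natAbs, ← Int.natCast_natAbs, ZMod.natAbs_valMinAbs_neg]
  constructor
  · rw [mem_reach]
    intro j
    have hj := h j
    rwa [Pi.sub_apply] at hj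
  · rw [mem_reach]
    intro j
    have hj := h j
    rw [Pi.sub_apply] at hj
    unfold coord
    rw [show u j - v j = -(v j - u j) by ring, habs]
    exact hj

end PTFun

end LongRangePhi4

end Literature.Barriers.CriticalPhenomena

end
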